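import Mathlib
import HarnessLib
import Summits.Ventures.LatticeQCDFlow.Scoring.ChainBlockMarkov

/-!
# A law of large numbers ACROSS BLOCKS, from any start: for a bounded block functional `Ψ` of
# `b + 1` coordinates with `|E_z Ψ − L| ≤ δ` and `E_z Ψ² ≤ V` for every state `z`,
# `E_{μ₀} |(1/a) Σ_{j<a} Ψ(X_{bj}, …, X_{bj+b}) − L| ≤ δ + 2 √(V/a)`

HONEST FRAMING: exact (Metropolis-corrected) sampling algorithms for lattice gauge theory;
figures of merit are autocorrelation/cost numbers at stated couplings and volumes; no
continuum-physics claim.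

Venture `LatticeQCDFlow` (cell pub-lqcd), topic `Scoring`; FANOUT row 4 (`s0-u1-b`, GEN-30).
NEW WORK of the cell, not a published result; no definition is introduced; nothing is cited as a
fact.  `P_{μ₀}` is the chain's path law from ANY initial law, `P_{δ_z}` the law from the state `z`
(`Scoring/ChainBlockMarkov.lean`: Markov property with a past weight and a future path functional,
and orthogonality of conditionally centred block functionals).  WHY: the quadratic variation of the
martingale array behind the batch-means CLT (row 4's `τ_int` column) is a BLOCK AVERAGE
`(1/a) Σ_{j<a} Ψ_b(X_{bj}, …, X_{bj+b})` whose blockwise mean from every state is `2σ⁴ + O(1/√b)`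
and whose blockwise second moment is bounded; this file turns such ANY-STATE information into an
`L¹` law of large numbers with NO mixing rate and NO stationarity: centre each block at its
conditional mean `φ(X_{bj}) = E_{X_{bj}} Ψ`; the centred blocks are orthogonal with second moment
`≤ 4V`, so their average is `≤ 2√(V/a)` in `L¹`, and the conditional means are within `δ` of `L`.

## Content (`Ψ` measurable, `DependsOn Ψ (Set.Iic b)`, `|Ψ| ≤ C_Ψ`; `a ≥ 1`)

* **`chain_block_centred_orthogonal`** — `j ≠ k` ⇒ `E_{μ₀}[(Ψ_j − φ(X_{bj}))(Ψ_k − φ(X_{bk}))] = 0`;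
* **`chain_block_centred_sq_integral_le`** — `E_{μ₀}[(Ψ_j − φ(X_{bj}))²] ≤ 4V`;
* **`chain_blockAverage_abs_sub_integral_le`** — `E_{μ₀} |(1/a) Σ_{j<a} Ψ_j − L| ≤ δ + 2 √(V/a)`.
NOT CLAIMED: almost-sure versions; unbounded functionals; overlapping blocks.
-/

noncomputable section

namespace Summit.Ventures.LatticeQCDFlow.Scoring

open MeasureTheory ProbabilityTheory Filter Finset Preorder
open scoped ENNReal Topology

variable {Ω : Type*} [MeasurableSpace Ω]

section Chain

variable (κ : Kernel Ω Ω) [IsMarkovKernel κ] (μ₀ : Measure Ω) [IsProbabilityMeasure μ₀]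

omit [MeasurableSpace Ω] in
/-- A block functional shifted to block `j` depends on the coordinates up to `b j + b`. -/
theorem block_shift_dependsOn {Ψ : (ℕ → Ω) → ℝ} {b : ℕ} (hΨd : DependsOn Ψ (Set.Iic b)) (j : ℕ) :
    DependsOn (fun x : ℕ → Ω => Ψ (fun n => x (b * j + n))) (Set.Iic (b * j + b)) := by
  intro x y hxy
  exact hΨd fun n hn => hxy (b * j + n) (Set.mem_Iic.2 (Nat.add_le_add_left (Set.mem_Iic.1 hn) _))

omit [IsProbabilityMeasure μ₀] in
/-- Measurability of a shifted block functional. -/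
theorem measurable_block_shift {Ψ : (ℕ → Ω) → ℝ} (hΨ : Measurable Ψ) (b j : ℕ) :
    Measurable fun x : ℕ → Ω => Ψ (fun n => x (b * j + n)) :=
  hΨ.comp (measurable_pi_lambda _ fun _ => measurable_pi_apply _)

/-- **CONDITIONALLY CENTRED BLOCKS ARE ORTHOGONAL**: for `j ≠ k`,
`E_{μ₀}[(Ψ_j − φ(X_{bj})) (Ψ_k − φ(X_{bk}))] = 0`, `φ(z) = E_z Ψ`. -/
theorem chain_block_centred_orthogonal {Ψ : (ℕ → Ω) → ℝ} (hΨ : Measurable Ψ) {b : ℕ}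
    (hΨd : DependsOn Ψ (Set.Iic b)) {CΨ : ℝ} (hΨb : ∀ y, |Ψ y| ≤ CΨ) {j k : ℕ} (hjk : j ≠ k) :
    ∫ x, (Ψ (fun n => x (b * j + n)) - ∫ y, Ψ y ∂(Kernel.trajMeasure (X := fun _ : ℕ => Ω) (Measure.dirac (x (b * j)))
          (fun n : ℕ => κ.comap (fun h' : (i : ↥(Finset.Iic n)) → Ω => h' ⟨n, Finset.mem_Iic.2 le_rfl⟩)
            (measurable_pi_apply _))))
        * (Ψ (fun n => x (b * k + n)) - ∫ y, Ψ y ∂(Kernel.trajMeasure (X := fun _ : ℕ => Ω) (Measure.dirac (x (b * k)))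
              (fun n : ℕ => κ.comap (fun h' : (i : ↥(Finset.Iic n)) → Ω => h' ⟨n, Finset.mem_Iic.2 le_rfl⟩)
                (measurable_pi_apply _)))) ∂(Kernel.trajMeasure (X := fun _ : ℕ => Ω) (μ₀)
              (fun n : ℕ => κ.comap (fun h' : (i : ↥(Finset.Iic n)) → Ω => h' ⟨n, Finset.mem_Iic.2 le_rfl⟩)
                (measurable_pi_apply _))) = 0 := by
  have hCΨ0 : 0 ≤ CΨ := (abs_nonneg _).trans (hΨb (fun _ => Classical.choice
    (nonempty_of_isProbabilityMeasure μ₀)))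
  have hφm := measurable_chain_dirac_integral κ hΨ
  have hφb := fun z => abs_chain_dirac_integral_le κ hΨb z
  have key : ∀ {j k : ℕ}, j < k →
      ∫ x, (Ψ (fun n => x (b * j + n)) - ∫ y, Ψ y ∂(Kernel.trajMeasure (X := fun _ : ℕ => Ω) (Measure.dirac (x (b * j)))
            (fun n : ℕ => κ.comap (fun h' : (i : ↥(Finset.Iic n)) → Ω => h' ⟨n, Finset.mem_Iic.2 le_rfl⟩)
              (measurable_pi_apply _))))
        * (Ψ (fun n => x (b * k + n)) - ∫ y, Ψ y ∂(Kernel.trajMeasure (X := fun _ : ℕ => Ω) (Measure.dirac (x (b * k)))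
              (fun n : ℕ => κ.comap (fun h' : (i : ↥(Finset.Iic n)) → Ω => h' ⟨n, Finset.mem_Iic.2 le_rfl⟩)
                (measurable_pi_apply _)))) ∂(Kernel.trajMeasure (X := fun _ : ℕ => Ω) (μ₀)
              (fun n : ℕ => κ.comap (fun h' : (i : ↥(Finset.Iic n)) → Ω => h' ⟨n, Finset.mem_Iic.2 le_rfl⟩)
                (measurable_pi_apply _))) = 0 := by
    intro j k hjk
    have hGm : Measurable fun x : ℕ → Ω =>
        Ψ (fun n => x (b * j + n)) - ∫ y, Ψ y ∂(Kernel.trajMeasure (X := fun _ : ℕ => Ω) (Measure.dirac (x (b * j)))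
              (fun n : ℕ => κ.comap (fun h' : (i : ↥(Finset.Iic n)) → Ω => h' ⟨n, Finset.mem_Iic.2 le_rfl⟩)
                (measurable_pi_apply _))) :=
      (measurable_block_shift hΨ b j).sub (hφm.comp (measurable_pi_apply _))
    have hGd : DependsOn (fun x : ℕ → Ω =>
        Ψ (fun n => x (b * j + n)) - ∫ y, Ψ y ∂(Kernel.trajMeasure (X := fun _ : ℕ => Ω) (Measure.dirac (x (b * j)))
              (fun n : ℕ => κ.comap (fun h' : (i : ↥(Finset.Iic n)) → Ω => h' ⟨n, Finset.mem_Iic.2 le_rfl⟩)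
                (measurable_pi_apply _)))) (Set.Iic (b * k)) := by
      intro x y hxy
      have hle : b * j + b ≤ b * k := by
        rw [← Nat.mul_succ]; exact Nat.mul_le_mul_left b (Nat.succ_le_of_lt hjk)
      have h1 := block_shift_dependsOn hΨd j fun n hn => hxy n (Set.mem_Iic.2
        ((Set.mem_Iic.1 hn).trans hle))
      have h2 : x (b * j) = y (b * j) := hxy _ (Set.mem_Iic.2 ((Nat.le_add_right _ _).trans hle))
      dsimp only at h1 ⊢
      rw [h1, h2]
    have hGb : ∀ x : ℕ → Ω,
        |Ψ (fun n => x (b * j + n)) - ∫ y, Ψ y ∂(Kernel.trajMeasure (X := fun _ : ℕ => Ω) (Measure.dirac (x (b * j)))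
              (fun n : ℕ => κ.comap (fun h' : (i : ↥(Finset.Iic n)) → Ω => h' ⟨n, Finset.mem_Iic.2 le_rfl⟩)
                (measurable_pi_apply _)))| ≤ CΨ + CΨ :=
      fun x => (abs_sub _ _).trans (add_le_add (hΨb _) (hφb _))
    exact chain_shift_centred_orthogonal κ μ₀ (b * k) hGm hGd hGb hΨ hΨb
  rcases lt_or_gt_of_ne hjk with h | h
  · exact key h
  · rw [← key h]
    exact integral_congr_ae (ae_of_all _ fun x => mul_comm _ _)

/-- **SECOND MOMENT OF A CENTRED BLOCK**: if `E_z Ψ² ≤ V` for every state `z` then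
`E_{μ₀}[(Ψ_j − φ(X_{bj}))²] ≤ 4V`. -/
theorem chain_block_centred_sq_integral_le {Ψ : (ℕ → Ω) → ℝ} (hΨ : Measurable Ψ) (b : ℕ)
    {CΨ : ℝ} (hΨb : ∀ y, |Ψ y| ≤ CΨ) {V : ℝ}
    (hV : ∀ z, ∫ y, Ψ y ^ 2 ∂(Kernel.trajMeasure (X := fun _ : ℕ => Ω) (Measure.dirac z)
          (fun n : ℕ => κ.comap (fun h' : (i : ↥(Finset.Iic n)) → Ω => h' ⟨n, Finset.mem_Iic.2 le_rfl⟩)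
            (measurable_pi_apply _))) ≤ V) (j : ℕ) :
    ∫ x, (Ψ (fun n => x (b * j + n)) - ∫ y, Ψ y ∂(Kernel.trajMeasure (X := fun _ : ℕ => Ω) (Measure.dirac (x (b * j)))
          (fun n : ℕ => κ.comap (fun h' : (i : ↥(Finset.Iic n)) → Ω => h' ⟨n, Finset.mem_Iic.2 le_rfl⟩)
            (measurable_pi_apply _)))) ^ 2 ∂(Kernel.trajMeasure (X := fun _ : ℕ => Ω) (μ₀)
          (fun n : ℕ => κ.comap (fun h' : (i : ↥(Finset.Iic n)) → Ω => h' ⟨n, Finset.mem_Iic.2 le_rfl⟩)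
            (measurable_pi_apply _)))
      ≤ 4 * V := by
  set P := (Kernel.trajMeasure (X := fun _ : ℕ => Ω) (μ₀)
        (fun n : ℕ => κ.comap (fun h' : (i : ↥(Finset.Iic n)) → Ω => h' ⟨n, Finset.mem_Iic.2 le_rfl⟩)
          (measurable_pi_apply _))) with hP
  have hCΨ0 : 0 ≤ CΨ := (abs_nonneg _).trans (hΨb (fun _ => Classical.choice
    (nonempty_of_isProbabilityMeasure μ₀)))
  have hφm := measurable_chain_dirac_integral κ hΨ
  have hφb := fun z => abs_chain_dirac_integral_le κ hΨb z
  have hΨ2m : Measurable fun y => Ψ y ^ 2 := hΨ.pow_const 2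
  have hΨ2b : ∀ y, |Ψ y ^ 2| ≤ CΨ ^ 2 := fun y => by
    rw [abs_pow]; exact pow_le_pow_left₀ (abs_nonneg _) (hΨb y) 2
  have hE2m := measurable_chain_dirac_integral κ hΨ2m
  have hE2b := fun z => abs_chain_dirac_integral_le κ hΨ2b z
  have h1 : ∫ x, Ψ (fun n => x (b * j + n)) ^ 2 ∂P ≤ V := by
    have hM := chain_markov_dependsOn κ μ₀ (b * j) (G := fun _ => (1 : ℝ)) measurable_const
      (dependsOn_const _ |>.mono (Set.empty_subset _)) (CG := 1) (fun _ => by simp) hΨ2m hΨ2b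
    rw [← hP] at hM
    simp only [one_mul] at hM
    rw [hM]
    calc ∫ x, (∫ y, Ψ y ^ 2 ∂(Kernel.trajMeasure (X := fun _ : ℕ => Ω) (Measure.dirac (x (b * j)))
          (fun n : ℕ => κ.comap (fun h' : (i : ↥(Finset.Iic n)) → Ω => h' ⟨n, Finset.mem_Iic.2 le_rfl⟩)
            (measurable_pi_apply _)))) ∂P ≤ ∫ _x, V ∂P :=
          integral_mono (integrable_of_bounded P (hE2m.comp (measurable_pi_apply _))
            (fun x => hE2b _)) (integrable_const _) fun x => hV _
      _ = V := by rw [integral_const, probReal_univ, one_smul]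
  have h2 : ∫ x, (∫ y, Ψ y ∂(Kernel.trajMeasure (X := fun _ : ℕ => Ω) (Measure.dirac (x (b * j)))
        (fun n : ℕ => κ.comap (fun h' : (i : ↥(Finset.Iic n)) → Ω => h' ⟨n, Finset.mem_Iic.2 le_rfl⟩)
          (measurable_pi_apply _)))) ^ 2 ∂P ≤ V := by
    calc ∫ x, (∫ y, Ψ y ∂(Kernel.trajMeasure (X := fun _ : ℕ => Ω) (Measure.dirac (x (b * j)))
          (fun n : ℕ => κ.comap (fun h' : (i : ↥(Finset.Iic n)) → Ω => h' ⟨n, Finset.mem_Iic.2 le_rfl⟩)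
            (measurable_pi_apply _)))) ^ 2 ∂P
        ≤ ∫ x, (∫ y, Ψ y ^ 2 ∂(Kernel.trajMeasure (X := fun _ : ℕ => Ω) (Measure.dirac (x (b * j)))
              (fun n : ℕ => κ.comap (fun h' : (i : ↥(Finset.Iic n)) → Ω => h' ⟨n, Finset.mem_Iic.2 le_rfl⟩)
                (measurable_pi_apply _)))) ∂P :=
          integral_mono (integrable_of_bounded P ((hφm.comp (measurable_pi_apply _)).pow_const 2)
            (C := CΨ ^ 2) fun x => by
              rw [abs_pow]; exact pow_le_pow_left₀ (abs_nonneg _) (hφb _) 2)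
            (integrable_of_bounded P (hE2m.comp (measurable_pi_apply _)) (fun x => hE2b _))
            fun x => sq_integral_le_integral_sq _ hΨ hΨb
      _ ≤ ∫ _x, V ∂P := integral_mono (integrable_of_bounded P (hE2m.comp (measurable_pi_apply _))
            (fun x => hE2b _)) (integrable_const _) fun x => hV _
      _ = V := by rw [integral_const, probReal_univ, one_smul]
  have hi1 : Integrable (fun x : ℕ → Ω => Ψ (fun n => x (b * j + n)) ^ 2) P :=
    integrable_of_bounded P ((measurable_block_shift hΨ b j).pow_const 2) (C := CΨ ^ 2) fun x => by
      rw [abs_pow]; exact pow_le_pow_left₀ (abs_nonneg _) (hΨb _) 2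
  have hi2 : Integrable (fun x : ℕ → Ω => (∫ y, Ψ y ∂(Kernel.trajMeasure (X := fun _ : ℕ => Ω) (Measure.dirac (x (b * j)))
        (fun n : ℕ => κ.comap (fun h' : (i : ↥(Finset.Iic n)) → Ω => h' ⟨n, Finset.mem_Iic.2 le_rfl⟩)
          (measurable_pi_apply _)))) ^ 2) P :=
    integrable_of_bounded P ((hφm.comp (measurable_pi_apply _)).pow_const 2) (C := CΨ ^ 2)
      fun x => by rw [abs_pow]; exact pow_le_pow_left₀ (abs_nonneg _) (hφb _) 2
  have hiS : Integrable (fun x : ℕ → Ω => 2 * Ψ (fun n => x (b * j + n)) ^ 2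
      + 2 * (∫ y, Ψ y ∂(Kernel.trajMeasure (X := fun _ : ℕ => Ω) (Measure.dirac (x (b * j)))
            (fun n : ℕ => κ.comap (fun h' : (i : ↥(Finset.Iic n)) → Ω => h' ⟨n, Finset.mem_Iic.2 le_rfl⟩)
              (measurable_pi_apply _)))) ^ 2) P :=
    (hi1.const_mul 2).add (hi2.const_mul 2)
  have hpt : ∀ x : ℕ → Ω,
      (Ψ (fun n => x (b * j + n)) - ∫ y, Ψ y ∂(Kernel.trajMeasure (X := fun _ : ℕ => Ω) (Measure.dirac (x (b * j)))
            (fun n : ℕ => κ.comap (fun h' : (i : ↥(Finset.Iic n)) → Ω => h' ⟨n, Finset.mem_Iic.2 le_rfl⟩)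
              (measurable_pi_apply _)))) ^ 2
        ≤ 2 * Ψ (fun n => x (b * j + n)) ^ 2 + 2 * (∫ y, Ψ y ∂(Kernel.trajMeasure (X := fun _ : ℕ => Ω) (Measure.dirac (x (b * j)))
              (fun n : ℕ => κ.comap (fun h' : (i : ↥(Finset.Iic n)) → Ω => h' ⟨n, Finset.mem_Iic.2 le_rfl⟩)
                (measurable_pi_apply _)))) ^ 2 :=
    fun x => by nlinarith [sq_nonneg (Ψ (fun n => x (b * j + n)) + ∫ y, Ψ y ∂(Kernel.trajMeasure (X := fun _ : ℕ => Ω) (Measure.dirac (x (b * j)))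
          (fun n : ℕ => κ.comap (fun h' : (i : ↥(Finset.Iic n)) → Ω => h' ⟨n, Finset.mem_Iic.2 le_rfl⟩)
            (measurable_pi_apply _))))]
  have hmono := integral_mono_of_nonneg (μ := P) (ae_of_all _ fun x => sq_nonneg
    (Ψ (fun n => x (b * j + n)) - ∫ y, Ψ y ∂(Kernel.trajMeasure (X := fun _ : ℕ => Ω) (Measure.dirac (x (b * j)))
          (fun n : ℕ => κ.comap (fun h' : (i : ↥(Finset.Iic n)) → Ω => h' ⟨n, Finset.mem_Iic.2 le_rfl⟩)
            (measurable_pi_apply _))))) hiS (ae_of_all _ hpt)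
  have hsum : ∫ x, (2 * Ψ (fun n => x (b * j + n)) ^ 2
      + 2 * (∫ y, Ψ y ∂(Kernel.trajMeasure (X := fun _ : ℕ => Ω) (Measure.dirac (x (b * j)))
            (fun n : ℕ => κ.comap (fun h' : (i : ↥(Finset.Iic n)) → Ω => h' ⟨n, Finset.mem_Iic.2 le_rfl⟩)
              (measurable_pi_apply _)))) ^ 2) ∂P
      = 2 * ∫ x, Ψ (fun n => x (b * j + n)) ^ 2 ∂P
        + 2 * ∫ x, (∫ y, Ψ y ∂(Kernel.trajMeasure (X := fun _ : ℕ => Ω) (Measure.dirac (x (b * j)))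
              (fun n : ℕ => κ.comap (fun h' : (i : ↥(Finset.Iic n)) → Ω => h' ⟨n, Finset.mem_Iic.2 le_rfl⟩)
                (measurable_pi_apply _)))) ^ 2 ∂P := by
    rw [integral_add (hi1.const_mul 2) (hi2.const_mul 2), integral_const_mul, integral_const_mul]
  rw [hsum] at hmono
  linarith

/-- **THE LAW OF LARGE NUMBERS ACROSS BLOCKS, FROM ANY START (L¹ estimate).**  `Ψ` measurable with
`DependsOn Ψ (Set.Iic b)` and `|Ψ| ≤ C_Ψ`; `|E_z Ψ − L| ≤ δ` and `E_z Ψ² ≤ V` for every state `z`;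
`a ≥ 1`.  Then for EVERY initial law:
`E_{μ₀} |(Σ_{j<a} Ψ(n ↦ X_{bj+n}))/a − L| ≤ δ + 2 √(V/a)`. -/
theorem chain_blockAverage_abs_sub_integral_le {Ψ : (ℕ → Ω) → ℝ} (hΨ : Measurable Ψ) {b : ℕ}
    (hΨd : DependsOn Ψ (Set.Iic b)) {CΨ : ℝ} (hΨb : ∀ y, |Ψ y| ≤ CΨ) {L δ V : ℝ}
    (hmean : ∀ z, |∫ y, Ψ y ∂(Kernel.trajMeasure (X := fun _ : ℕ => Ω) (Measure.dirac z)
          (fun n : ℕ => κ.comap (fun h' : (i : ↥(Finset.Iic n)) → Ω => h' ⟨n, Finset.mem_Iic.2 le_rfl⟩)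
            (measurable_pi_apply _))) - L| ≤ δ)
    (hV : ∀ z, ∫ y, Ψ y ^ 2 ∂(Kernel.trajMeasure (X := fun _ : ℕ => Ω) (Measure.dirac z)
          (fun n : ℕ => κ.comap (fun h' : (i : ↥(Finset.Iic n)) → Ω => h' ⟨n, Finset.mem_Iic.2 le_rfl⟩)
            (measurable_pi_apply _))) ≤ V) {a : ℕ} (ha : 0 < a) :
    ∫ x, |(∑ j ∈ Finset.range a, Ψ (fun n => x (b * j + n))) / a - L| ∂(Kernel.trajMeasure (X := fun _ : ℕ => Ω) (μ₀)
          (fun n : ℕ => κ.comap (fun h' : (i : ↥(Finset.Iic n)) → Ω => h' ⟨n, Finset.mem_Iic.2 le_rfl⟩)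
            (measurable_pi_apply _)))
      ≤ δ + 2 * Real.sqrt (V / a) := by
  set P := (Kernel.trajMeasure (X := fun _ : ℕ => Ω) (μ₀)
        (fun n : ℕ => κ.comap (fun h' : (i : ↥(Finset.Iic n)) → Ω => h' ⟨n, Finset.mem_Iic.2 le_rfl⟩)
          (measurable_pi_apply _))) with hP
  have z₀ : Ω := Classical.choice (nonempty_of_isProbabilityMeasure μ₀)
  have hCΨ0 : 0 ≤ CΨ := (abs_nonneg _).trans (hΨb (fun _ => z₀))
  have hV0 : 0 ≤ V := (integral_nonneg fun y => sq_nonneg _).trans (hV z₀)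
  have hδ0 : 0 ≤ δ := (abs_nonneg _).trans (hmean z₀)
  have haR : (0 : ℝ) < a := Nat.cast_pos.2 ha
  have hφm := measurable_chain_dirac_integral κ hΨ
  have hφb := fun z => abs_chain_dirac_integral_le κ hΨb z
  have hYm : ∀ j, Measurable fun x : ℕ → Ω =>
      Ψ (fun n => x (b * j + n)) - ∫ y, Ψ y ∂(Kernel.trajMeasure (X := fun _ : ℕ => Ω) (Measure.dirac (x (b * j)))
            (fun n : ℕ => κ.comap (fun h' : (i : ↥(Finset.Iic n)) → Ω => h' ⟨n, Finset.mem_Iic.2 le_rfl⟩)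
              (measurable_pi_apply _))) := fun j =>
    (measurable_block_shift hΨ b j).sub (hφm.comp (measurable_pi_apply _))
  have hYb : ∀ j (x : ℕ → Ω),
      |Ψ (fun n => x (b * j + n)) - ∫ y, Ψ y ∂(Kernel.trajMeasure (X := fun _ : ℕ => Ω) (Measure.dirac (x (b * j)))
            (fun n : ℕ => κ.comap (fun h' : (i : ↥(Finset.Iic n)) → Ω => h' ⟨n, Finset.mem_Iic.2 le_rfl⟩)
              (measurable_pi_apply _)))| ≤ CΨ + CΨ :=
    fun j x => (abs_sub _ _).trans (add_le_add (hΨb _) (hφb _))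
  have hSm : Measurable fun x : ℕ → Ω => ∑ j ∈ Finset.range a,
      (Ψ (fun n => x (b * j + n)) - ∫ y, Ψ y ∂(Kernel.trajMeasure (X := fun _ : ℕ => Ω) (Measure.dirac (x (b * j)))
            (fun n : ℕ => κ.comap (fun h' : (i : ↥(Finset.Iic n)) → Ω => h' ⟨n, Finset.mem_Iic.2 le_rfl⟩)
              (measurable_pi_apply _)))) :=
    Finset.measurable_sum _ fun j _ => hYm j
  have hSb : ∀ x : ℕ → Ω, |∑ j ∈ Finset.range a,
      (Ψ (fun n => x (b * j + n)) - ∫ y, Ψ y ∂(Kernel.trajMeasure (X := fun _ : ℕ => Ω) (Measure.dirac (x (b * j)))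
            (fun n : ℕ => κ.comap (fun h' : (i : ↥(Finset.Iic n)) → Ω => h' ⟨n, Finset.mem_Iic.2 le_rfl⟩)
              (measurable_pi_apply _))))| ≤ a * (CΨ + CΨ) :=
    fun x => (Finset.abs_sum_le_sum_abs _ _).trans (by
      calc ∑ j ∈ Finset.range a, |Ψ (fun n => x (b * j + n))
            - ∫ y, Ψ y ∂(Kernel.trajMeasure (X := fun _ : ℕ => Ω) (Measure.dirac (x (b * j)))
                  (fun n : ℕ => κ.comap (fun h' : (i : ↥(Finset.Iic n)) → Ω => h' ⟨n, Finset.mem_Iic.2 le_rfl⟩)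
                    (measurable_pi_apply _)))|
          ≤ ∑ _j ∈ Finset.range a, (CΨ + CΨ) := Finset.sum_le_sum fun j _ => hYb j x
        _ = a * (CΨ + CΨ) := by rw [Finset.sum_const, Finset.card_range, nsmul_eq_mul])
  have hprod : ∀ j k, Integrable (fun x : ℕ → Ω =>
      (Ψ (fun n => x (b * j + n)) - ∫ y, Ψ y ∂(Kernel.trajMeasure (X := fun _ : ℕ => Ω) (Measure.dirac (x (b * j)))
            (fun n : ℕ => κ.comap (fun h' : (i : ↥(Finset.Iic n)) → Ω => h' ⟨n, Finset.mem_Iic.2 le_rfl⟩)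
              (measurable_pi_apply _))))
      * (Ψ (fun n => x (b * k + n)) - ∫ y, Ψ y ∂(Kernel.trajMeasure (X := fun _ : ℕ => Ω) (Measure.dirac (x (b * k)))
            (fun n : ℕ => κ.comap (fun h' : (i : ↥(Finset.Iic n)) → Ω => h' ⟨n, Finset.mem_Iic.2 le_rfl⟩)
              (measurable_pi_apply _))))) P := fun j k =>
    integrable_of_bounded P ((hYm j).mul (hYm k)) (C := (CΨ + CΨ) * (CΨ + CΨ)) fun x => by
      rw [abs_mul]; exact mul_le_mul (hYb j x) (hYb k x) (abs_nonneg _) (by positivity)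
  have hS2 : ∫ x, (∑ j ∈ Finset.range a,
      (Ψ (fun n => x (b * j + n)) - ∫ y, Ψ y ∂(Kernel.trajMeasure (X := fun _ : ℕ => Ω) (Measure.dirac (x (b * j)))
            (fun n : ℕ => κ.comap (fun h' : (i : ↥(Finset.Iic n)) → Ω => h' ⟨n, Finset.mem_Iic.2 le_rfl⟩)
              (measurable_pi_apply _))))) ^ 2 ∂P ≤ 4 * a * V := by
    have hexp : ∀ x : ℕ → Ω, (∑ j ∈ Finset.range a,
        (Ψ (fun n => x (b * j + n)) - ∫ y, Ψ y ∂(Kernel.trajMeasure (X := fun _ : ℕ => Ω) (Measure.dirac (x (b * j)))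
              (fun n : ℕ => κ.comap (fun h' : (i : ↥(Finset.Iic n)) → Ω => h' ⟨n, Finset.mem_Iic.2 le_rfl⟩)
                (measurable_pi_apply _))))) ^ 2
        = ∑ j ∈ Finset.range a, ∑ k ∈ Finset.range a,
          (Ψ (fun n => x (b * j + n)) - ∫ y, Ψ y ∂(Kernel.trajMeasure (X := fun _ : ℕ => Ω) (Measure.dirac (x (b * j)))
                (fun n : ℕ => κ.comap (fun h' : (i : ↥(Finset.Iic n)) → Ω => h' ⟨n, Finset.mem_Iic.2 le_rfl⟩)
                  (measurable_pi_apply _))))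
          * (Ψ (fun n => x (b * k + n)) - ∫ y, Ψ y ∂(Kernel.trajMeasure (X := fun _ : ℕ => Ω) (Measure.dirac (x (b * k)))
                (fun n : ℕ => κ.comap (fun h' : (i : ↥(Finset.Iic n)) → Ω => h' ⟨n, Finset.mem_Iic.2 le_rfl⟩)
                  (measurable_pi_apply _)))) := fun x => by
      rw [sq, Finset.sum_mul_sum]
    rw [integral_congr_ae (ae_of_all _ hexp),
      integral_finsetSum _ (fun j _ => integrable_finsetSum _ fun k _ => hprod j k)]
    have hrow : ∀ j ∈ Finset.range a, ∫ x, ∑ k ∈ Finset.range a,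
        (Ψ (fun n => x (b * j + n)) - ∫ y, Ψ y ∂(Kernel.trajMeasure (X := fun _ : ℕ => Ω) (Measure.dirac (x (b * j)))
              (fun n : ℕ => κ.comap (fun h' : (i : ↥(Finset.Iic n)) → Ω => h' ⟨n, Finset.mem_Iic.2 le_rfl⟩)
                (measurable_pi_apply _))))
          * (Ψ (fun n => x (b * k + n)) - ∫ y, Ψ y ∂(Kernel.trajMeasure (X := fun _ : ℕ => Ω) (Measure.dirac (x (b * k)))
                (fun n : ℕ => κ.comap (fun h' : (i : ↥(Finset.Iic n)) → Ω => h' ⟨n, Finset.mem_Iic.2 le_rfl⟩)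
                  (measurable_pi_apply _)))) ∂P ≤ 4 * V := by
      intro j hj
      rw [integral_finsetSum _ (fun k _ => hprod j k), Finset.sum_eq_single_of_mem j hj
        (fun k _ hkj => by
          have := chain_block_centred_orthogonal κ μ₀ hΨ hΨd hΨb (Ne.symm hkj)
          rwa [← hP] at this)]
      have := chain_block_centred_sq_integral_le κ μ₀ hΨ b hΨb hV j
      rw [← hP] at this
      simpa only [sq] using this
    calc ∑ j ∈ Finset.range a, ∫ x, ∑ k ∈ Finset.range a,
          (Ψ (fun n => x (b * j + n)) - ∫ y, Ψ y ∂(Kernel.trajMeasure (X := fun _ : ℕ => Ω) (Measure.dirac (x (b * j)))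
                (fun n : ℕ => κ.comap (fun h' : (i : ↥(Finset.Iic n)) → Ω => h' ⟨n, Finset.mem_Iic.2 le_rfl⟩)
                  (measurable_pi_apply _))))
            * (Ψ (fun n => x (b * k + n)) - ∫ y, Ψ y ∂(Kernel.trajMeasure (X := fun _ : ℕ => Ω) (Measure.dirac (x (b * k)))
                  (fun n : ℕ => κ.comap (fun h' : (i : ↥(Finset.Iic n)) → Ω => h' ⟨n, Finset.mem_Iic.2 le_rfl⟩)
                    (measurable_pi_apply _)))) ∂P
        ≤ ∑ _j ∈ Finset.range a, 4 * V := Finset.sum_le_sum hrow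
      _ = 4 * a * V := by rw [Finset.sum_const, Finset.card_range, nsmul_eq_mul]; ring
  have hS1 : ∫ x, |∑ j ∈ Finset.range a,
      (Ψ (fun n => x (b * j + n)) - ∫ y, Ψ y ∂(Kernel.trajMeasure (X := fun _ : ℕ => Ω) (Measure.dirac (x (b * j)))
            (fun n : ℕ => κ.comap (fun h' : (i : ↥(Finset.Iic n)) → Ω => h' ⟨n, Finset.mem_Iic.2 le_rfl⟩)
              (measurable_pi_apply _))))| ∂P
      ≤ 2 * Real.sqrt (a * V) := by
    have hJ := sq_integral_le_integral_sq P hSm.abs (C := a * (CΨ + CΨ))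
      (fun x => by rw [abs_abs]; exact hSb x)
    simp only [sq_abs] at hJ
    have h0 : 0 ≤ ∫ x, |∑ j ∈ Finset.range a,
        (Ψ (fun n => x (b * j + n)) - ∫ y, Ψ y ∂(Kernel.trajMeasure (X := fun _ : ℕ => Ω) (Measure.dirac (x (b * j)))
              (fun n : ℕ => κ.comap (fun h' : (i : ↥(Finset.Iic n)) → Ω => h' ⟨n, Finset.mem_Iic.2 le_rfl⟩)
                (measurable_pi_apply _))))| ∂P :=
      integral_nonneg fun x => abs_nonneg _
    have h1 : (∫ x, |∑ j ∈ Finset.range a,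
        (Ψ (fun n => x (b * j + n)) - ∫ y, Ψ y ∂(Kernel.trajMeasure (X := fun _ : ℕ => Ω) (Measure.dirac (x (b * j)))
              (fun n : ℕ => κ.comap (fun h' : (i : ↥(Finset.Iic n)) → Ω => h' ⟨n, Finset.mem_Iic.2 le_rfl⟩)
                (measurable_pi_apply _))))| ∂P) ^ 2
        ≤ (2 * Real.sqrt (a * V)) ^ 2 := by
      rw [mul_pow, Real.sq_sqrt (by positivity)]; linarith
    exact (pow_le_pow_iff_left₀ h0 (by positivity) two_ne_zero).1 h1
  have hmeanAvg : ∀ x : ℕ → Ω,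
      |(∑ j ∈ Finset.range a, ∫ y, Ψ y ∂(Kernel.trajMeasure (X := fun _ : ℕ => Ω) (Measure.dirac (x (b * j)))
            (fun n : ℕ => κ.comap (fun h' : (i : ↥(Finset.Iic n)) → Ω => h' ⟨n, Finset.mem_Iic.2 le_rfl⟩)
              (measurable_pi_apply _)))) / a - L| ≤ δ := by
    intro x
    have hrew : (∑ j ∈ Finset.range a, ∫ y, Ψ y ∂(Kernel.trajMeasure (X := fun _ : ℕ => Ω) (Measure.dirac (x (b * j)))
          (fun n : ℕ => κ.comap (fun h' : (i : ↥(Finset.Iic n)) → Ω => h' ⟨n, Finset.mem_Iic.2 le_rfl⟩)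
            (measurable_pi_apply _)))) / a - L
        = (∑ j ∈ Finset.range a, (∫ y, Ψ y ∂(Kernel.trajMeasure (X := fun _ : ℕ => Ω) (Measure.dirac (x (b * j)))
              (fun n : ℕ => κ.comap (fun h' : (i : ↥(Finset.Iic n)) → Ω => h' ⟨n, Finset.mem_Iic.2 le_rfl⟩)
                (measurable_pi_apply _))) - L)) / a := by
      rw [Finset.sum_sub_distrib, Finset.sum_const, Finset.card_range, nsmul_eq_mul]
      field_simp
    rw [hrew, abs_div, abs_of_pos haR, div_le_iff₀ haR]
    calc |∑ j ∈ Finset.range a, (∫ y, Ψ y ∂(Kernel.trajMeasure (X := fun _ : ℕ => Ω) (Measure.dirac (x (b * j)))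
          (fun n : ℕ => κ.comap (fun h' : (i : ↥(Finset.Iic n)) → Ω => h' ⟨n, Finset.mem_Iic.2 le_rfl⟩)
            (measurable_pi_apply _))) - L)|
        ≤ ∑ j ∈ Finset.range a, |∫ y, Ψ y ∂(Kernel.trajMeasure (X := fun _ : ℕ => Ω) (Measure.dirac (x (b * j)))
              (fun n : ℕ => κ.comap (fun h' : (i : ↥(Finset.Iic n)) → Ω => h' ⟨n, Finset.mem_Iic.2 le_rfl⟩)
                (measurable_pi_apply _))) - L| :=
          Finset.abs_sum_le_sum_abs _ _
      _ ≤ ∑ _j ∈ Finset.range a, δ := Finset.sum_le_sum fun j _ => hmean _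
      _ = δ * a := by rw [Finset.sum_const, Finset.card_range, nsmul_eq_mul, mul_comm]
  have hsplit : ∀ x : ℕ → Ω, (∑ j ∈ Finset.range a, Ψ (fun n => x (b * j + n))) / a - L
      = (∑ j ∈ Finset.range a,
          (Ψ (fun n => x (b * j + n)) - ∫ y, Ψ y ∂(Kernel.trajMeasure (X := fun _ : ℕ => Ω) (Measure.dirac (x (b * j)))
                (fun n : ℕ => κ.comap (fun h' : (i : ↥(Finset.Iic n)) → Ω => h' ⟨n, Finset.mem_Iic.2 le_rfl⟩)
                  (measurable_pi_apply _))))) / a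
        + ((∑ j ∈ Finset.range a, ∫ y, Ψ y ∂(Kernel.trajMeasure (X := fun _ : ℕ => Ω) (Measure.dirac (x (b * j)))
              (fun n : ℕ => κ.comap (fun h' : (i : ↥(Finset.Iic n)) → Ω => h' ⟨n, Finset.mem_Iic.2 le_rfl⟩)
                (measurable_pi_apply _)))) / a - L) := by
    intro x; rw [Finset.sum_sub_distrib]; ring
  have hiA : Integrable (fun x : ℕ → Ω => |∑ j ∈ Finset.range a,
      (Ψ (fun n => x (b * j + n)) - ∫ y, Ψ y ∂(Kernel.trajMeasure (X := fun _ : ℕ => Ω) (Measure.dirac (x (b * j)))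
            (fun n : ℕ => κ.comap (fun h' : (i : ↥(Finset.Iic n)) → Ω => h' ⟨n, Finset.mem_Iic.2 le_rfl⟩)
              (measurable_pi_apply _))))| / a) P :=
    (integrable_of_bounded P hSm.abs (C := a * (CΨ + CΨ))
      (fun x => by rw [abs_abs]; exact hSb x)).div_const _
  have hsqrt : 2 * Real.sqrt (a * V) / a = 2 * Real.sqrt (V / a) := by
    have h1 : V / a = (a * V) / (a : ℝ) ^ 2 := by field_simp
    rw [h1, Real.sqrt_div (by positivity), Real.sqrt_sq haR.le]
    ring
  calc ∫ x, |(∑ j ∈ Finset.range a, Ψ (fun n => x (b * j + n))) / a - L| ∂P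
      ≤ ∫ x, (|∑ j ∈ Finset.range a,
          (Ψ (fun n => x (b * j + n)) - ∫ y, Ψ y ∂(Kernel.trajMeasure (X := fun _ : ℕ => Ω) (Measure.dirac (x (b * j)))
                (fun n : ℕ => κ.comap (fun h' : (i : ↥(Finset.Iic n)) → Ω => h' ⟨n, Finset.mem_Iic.2 le_rfl⟩)
                  (measurable_pi_apply _))))| / a + δ) ∂P := by
        refine integral_mono_of_nonneg (ae_of_all _ fun x => abs_nonneg _)
          (hiA.add (integrable_const _)) (ae_of_all _ fun x => ?_)
        dsimp only
        rw [hsplit x]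
        refine (abs_add_le _ _).trans (add_le_add ?_ (hmeanAvg x))
        rw [abs_div, abs_of_pos haR]
    _ = (∫ x, |∑ j ∈ Finset.range a,
          (Ψ (fun n => x (b * j + n)) - ∫ y, Ψ y ∂(Kernel.trajMeasure (X := fun _ : ℕ => Ω) (Measure.dirac (x (b * j)))
                (fun n : ℕ => κ.comap (fun h' : (i : ↥(Finset.Iic n)) → Ω => h' ⟨n, Finset.mem_Iic.2 le_rfl⟩)
                  (measurable_pi_apply _))))| ∂P) / a + δ := by
        rw [integral_add hiA (integrable_const _), integral_const, probReal_univ, one_smul,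
          integral_div]
    _ ≤ 2 * Real.sqrt (a * V) / a + δ := by
        have := div_le_div_of_nonneg_right hS1 haR.le
        linarith
    _ = δ + 2 * Real.sqrt (V / a) := by rw [hsqrt, add_comm]

end Chain

end Summit.Ventures.LatticeQCDFlow.Scoring

end
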